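import Summits.Ventures.PercRepro.S1ChainCq
import Summits.Ventures.PercRepro.S1ChainKill
import Summits.Ventures.PercRepro.S1ChainExcl

/-!
# PercRepro — A CELL BY THE CHAIN LEVERS (p2, gen 23; SUBCLAIM-S1 §6.8)

The coloop-free case of a cell on the actual triangle count `t = s₃` with the chain dichotomy (S1ChainCq): at
`t ≥ 1` choose `r = rr t` with `cq3 (r − 1) < t`; the chain gives `S` of nullity `≥ r` with a pairwise disjoint
family `𝒟` of triangles inside `S`. Writing `u = |S|`, EITHER (A) `|𝒟| ≥ u − 2r` and `≤ t − r` triangles lie outside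
`S`, OR (B) `|𝒟| ≥ u − 2r + 2` and none does. The kernel line at `(t, u)` takes the kill of `jd r u = max(u − 2r, 1)`
pairwise DISJOINT triangles (overlap `C(n − 6, p − 6)`, S1ChainKill) on the `Y`-side and the exclusion of the
independent four-sets with `≥ k = d + 1 − r` points outside `S` on the `U`-side (S1Nullity; at `m = |E ∖ S| = 2 = k`
the refined count of S1ChainExcl) — one `decide` per `(t, u)`, `u ∈ [3, 3r]` for (A) and `u ∈ [3, 3r − 3]` for (B).

* `jd`, `exclXc` — the table functions of the kernel lines;
* **`rls_of_ladder_case_chain`** — one ladder case (`c` coloops) from the chain lines.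
Axioms: standard.
-/

open scoped Matroid

namespace PercRepro

namespace S1

open Set

variable {α : Type}

/-- The number of pairwise disjoint triangles used in the kill at union size `u`: `max (u − 2r) 1`. -/
def jd (r u : ℕ) : ℕ := max (u - 2 * r) 1

/-- The exclusion credit of a chain line: `0` unless `2 ≤ k ≤ 4`; the refined count at `m = 2 = k`
(`exclCount n 2 2 − S − (n − 3) − (t − r)`), otherwise `exclX n m k S t r`. -/
def exclXc (n m k S t r : ℕ) : ℕ :=
  if 2 ≤ k ∧ k ≤ 4 then (if m = 2 ∧ k = 2 then exclCount n 2 2 - S - (n - 3) - (t - r) else exclX n m k S t r)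
  else 0

/-- **ONE LADDER CASE BY THE CHAIN LEVERS**: a finite `e`-free core of rank `p0 = p + c` (`p ≥ 6`) on `n = p0 + d`
points (`d ≥ 4`) with EXACTLY `c` coloops satisfies `RLS` at `(p0, 4)` (the four-circuit cap `S` supplied for the
coloop-free part, e.g. the series-class cap `gb`) once: at `t = s₃ = 0` the plain line
`ladderOK`; at `t ∈ [1, P]` with `r = rr t` (`1 ≤ r`, `cq3 (r − 1) < t`, `cq3` monotone below `r`) the chain lines
(A) for every `u ∈ [3, 3r]` (kill `jd r u`, exclusion with `t − r` outside triangles) and (B) for every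
`u ∈ [3, 3r − 3]` (kill `jd (r − 1) u`, no outside triangle). -/
theorem rls_of_ladder_case_chain (M : Matroid α) [M.Finite] {p0 p c d n : ℕ} (hp0 : p0 = p + c) (hnd : n = p0 + d)
    (hR : M.eRank = (p0 : ℕ∞)) (hn : M.E.ncard = n)
    (hfree : ∀ e ∈ M.E, ∃ A ⊆ M.E \ {e}, e ∉ M.closure A ∧ e ∉ M.closure ((M.E \ {e}) \ A))
    (hc : M.coloops.ncard = c) (hp : 6 ≤ p) (hd4 : 4 ≤ d) {P S S5 : ℕ}
    (hP : min ((p + d) * TriangleCap.cq3 (d - 1) / (p + d - 3)) (TriangleCap.cq3 d) ≤ P)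
    (hScap : ∀ (N : Matroid α) [N.Finite],
      (∀ e ∈ N.E, ∃ A ⊆ N.E \ {e}, e ∉ N.closure A ∧ e ∉ N.closure ((N.E \ {e}) \ A)) →
      N.E.encard = N.eRank + ((d : ℕ) : ℕ∞) → N.E.ncard = p + d → N.coloops = ∅ →
      {C : Set α | N.IsCircuit C ∧ C.ncard = 4}.ncard ≤ S)
    (hS5 : (p + d) * avgChain5b (d - 1) / (p + d - 5) ≤ S5)
    (rr : ℕ → ℕ)
    (hrr : ∀ t ∈ Finset.Icc 1 P, 1 ≤ rr t ∧ TriangleCap.cq3 (rr t - 1) < t ∧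
      ∀ ν < rr t, TriangleCap.cq3 ν ≤ TriangleCap.cq3 (rr t - 1))
    (hzero : ladderOK p0 p d 0 S S5 (∑ j ∈ Finset.range c, 2 ^ (n - 1 - j))
      (∑ j ∈ Finset.range c, w3plus (n - 1 - j)) = true)
    (hokA : ∀ t ∈ Finset.Icc 1 P, ∀ u ∈ Finset.Icc 3 (3 * rr t),
      killnullOK p0 p d t S S5 ((∑ j ∈ Finset.range c, 2 ^ (n - 1 - j)) + jd (rr t) u * (p + d - 3).choose (p - 3))
        ((∑ j ∈ Finset.range c, w3plus (n - 1 - j)) + (jd (rr t) u).choose 2 * (p + d - 6).choose (p - 6))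
        (exclXc (p + d) (p + d - u) (d + 1 - rr t) S t (rr t)) = true)
    (hokB : ∀ t ∈ Finset.Icc 1 P, ∀ u ∈ Finset.Icc 3 (3 * rr t - 3),
      killnullOK p0 p d t S S5 ((∑ j ∈ Finset.range c, 2 ^ (n - 1 - j)) + jd (rr t - 1) u * (p + d - 3).choose (p - 3))
        ((∑ j ∈ Finset.range c, w3plus (n - 1 - j)) + (jd (rr t - 1) u).choose 2 * (p + d - 6).choose (p - 6))
        (exclXc (p + d) (p + d - u) (d + 1 - rr t) S t t) = true) :
    ThmN.RLS M p0 4 := by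
  subst hp0
  have hR' : M.eRank = ((p + c : ℕ) : ℕ∞) := hR
  obtain ⟨N, hNfin, hNR, hNn, hNcol, hNfree, hNtop, hNmid⟩ := ladder_exact c M p hR' (by omega) (by omega) hfree
  have hNn' : N.E.ncard = p + d := by omega
  have hNcol0 : N.coloops = ∅ := by
    have h0 : N.coloops.ncard = 0 := by omega
    exact (Set.ncard_eq_zero (N.ground_finite.subset N.coloops_subset_ground)).1 h0
  have hNd : N.E.encard = N.eRank + ((d - 1 + 1 : ℕ) : ℕ∞) := by
    rw [hNR, ← N.ground_finite.cast_ncard_eq, hNn', show d - 1 + 1 = d by omega]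
    push_cast
    ring
  have hNd' : N.E.encard = N.eRank + (((d - 1 : ℕ) : ℕ∞) + 1) := by rw [hNd, Nat.cast_succ]
  have hNdd : N.E.encard = N.eRank + ((d : ℕ) : ℕ∞) := by rw [hNd, show d - 1 + 1 = d by omega]
  have hP' : {C : Set α | N.IsCircuit C ∧ C.ncard = 3}.ncard ≤ P :=
    (le_min (ncard_triangles_le_of_coloopFree N hNfree hNd hNcol0 hNn' (by omega))
      (TriangleCap.core_ncard_triangles_le_cq3 N hNfree hNdd)).trans hP
  have hS' := hScap N hNfree hNdd hNn' hNcol0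
  have hS5' := (ncard_fiveCircuits_le_of_coloopFree N hNfree hNd' hNcol0 hNn' (by omega)).trans hS5
  -- the core facts of `N`
  have hL : ∀ e ∈ N.E, ¬ N.IsLoop e := ThmN.not_isLoop_of_free N hNfree
  have hs : ∀ e ∈ N.E, ∀ f ∈ N.E, e ≠ f → N.eRk {e, f} = 2 := by
    intro e he f hf hef
    have h2 : (2 : ℕ∞) ≤ N.eRk {e, f} :=
      ThmN.two_le_eRk_of_two_le_ncard_of_free N hNfree (pair_subset he hf) (by rw [ncard_pair hef])
    have h3 : N.eRk {e, f} ≤ 2 := by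
      have := N.eRk_le_encard {e, f}
      rwa [encard_pair hef] at this
    exact le_antisymm h3 h2
  have hcirc : ∀ C, N.IsCircuit C → 3 ≤ C.encard := ThmN.three_le_encard_of_circuit N hL hs
  have hC1 : ∀ L ⊆ N.E, N.eRk L = 2 → L.ncard ≤ 3 := by
    intro L hL' hr
    have := ThmN.ncard_add_one_le_two_pow_of_eRk_le N hL hNfree 2 L hL' hr.le
    omega
  set t := {C : Set α | N.IsCircuit C ∧ C.ncard = 3}.ncard with ht
  set A := ∑ j ∈ Finset.range c, 2 ^ (n - 1 - j) with hA
  set B := ∑ j ∈ Finset.range c, w3plus (n - 1 - j) with hB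
  -- a kernel line applied to a pairwise disjoint subfamily of size `j ≤ |𝒟|` and an exclusion `X`
  have hline : ∀ (𝒟 : Finset (Set α)), (∀ C ∈ 𝒟, N.IsCircuit C ∧ C.ncard = 3) →
      (∀ C ∈ 𝒟, ∀ C' ∈ 𝒟, C ≠ C' → Disjoint C C') → ∀ j, 1 ≤ j → j ≤ 𝒟.card →
      ∀ (Sn : Set α), Sn ⊆ N.E → ∀ (r kk X : ℕ), N.eRk Sn + (r : ℕ∞) ≤ (Sn.ncard : ℕ∞) → d + 1 ≤ kk + r →
      X ≤ {B : Set α | B ⊆ N.E ∧ B.ncard = 4 ∧ N.eRk B = 4 ∧ kk ≤ (B \ Sn).ncard}.ncard →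
      killnullOK (p + c) p d t S S5 (A + j * (p + d - 3).choose (p - 3))
        (B + j.choose 2 * (p + d - 6).choose (p - 6)) X = true →
      phiK (p + c) 4 * (Matroid.topCount N p 4 : ℚ) + B ≤ (Matroid.midCount N p 4 : ℚ) + A := by
    intro 𝒟 h𝒟 h𝒟disj j hj1 hj𝒟 Sn hSn r kk X hν hkk hX hok
    obtain ⟨𝒟', h𝒟'sub, h𝒟'card⟩ := Finset.exists_subset_card_eq hj𝒟
    have hpair : ∀ C ∈ 𝒟', ∀ C' ∈ 𝒟', C ≠ C' → 6 ≤ (C ∪ C').ncard := by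
      intro C hC C' hC' hne
      have hd := h𝒟disj C (h𝒟'sub hC) C' (h𝒟'sub hC') hne
      have hCfin : C.Finite := N.ground_finite.subset (h𝒟 C (h𝒟'sub hC)).1.subset_ground
      have hC'fin : C'.Finite := N.ground_finite.subset (h𝒟 C' (h𝒟'sub hC')).1.subset_ground
      rw [Set.ncard_union_eq hd hCfin hC'fin, (h𝒟 C (h𝒟'sub hC)).2, (h𝒟 C' (h𝒟'sub hC')).2]
    refine weighted_of_killnullOK_gen N (p + c) p d t S S5 A B X hd4 hNR hNn' hNfree le_rfl hS' hS5' (by omega)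
      (by omega) 3 (by omega) 6 (by omega) 𝒟' (fun C hC => h𝒟 C (h𝒟'sub hC)) hpair hSn hν hkk hX ?_
    rw [h𝒟'card]
    exact hok
  -- the weighted inequality on `N`
  have hw : phiK (p + c) 4 * (Matroid.topCount N p 4 : ℚ) + B ≤ (Matroid.midCount N p 4 : ℚ) + A := by
    rcases Nat.eq_zero_or_pos t with h0 | hpos
    · exact weighted_of_ladderOK N (p + c) p d 0 S S5 A B hd4 hNR hNn' hNfree (by rw [← ht, h0]) hS' hS5'
        (by omega) (by omega) hzero
    · have htI : t ∈ Finset.Icc 1 P := Finset.mem_Icc.2 ⟨hpos, hP'⟩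
      obtain ⟨hr1, hcq, hmono⟩ := hrr t htI
      set r := rr t with hr
      have hcq' : TriangleCap.cq3 (r - 1) < (ThmN.triangles N).ncard := hcq
      obtain ⟨Sn, hSnE, 𝒟, h𝒟mem, h𝒟disj, h𝒟pos, hSnν, hcase⟩ := exists_chain_set N hNfree r hr1 hcq' hmono
      have h𝒟tri : ∀ C ∈ 𝒟, N.IsCircuit C ∧ C.ncard = 3 := fun C hC => ⟨(h𝒟mem C hC).1, (h𝒟mem C hC).2.1⟩
      have hSnfin : Sn.Finite := N.ground_finite.subset hSnE
      -- `Sn` contains a triangle, so `|Sn| ≥ 3`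
      have hSn3 : 3 ≤ Sn.ncard := by
        obtain ⟨C, hC⟩ := Finset.card_pos.1 (by omega : 0 < 𝒟.card)
        have := Set.ncard_le_ncard (h𝒟mem C hC).2.2 hSnfin
        rw [(h𝒟mem C hC).2.1] at this
        exact this
      set u := Sn.ncard with hu
      set m := (N.E \ Sn).ncard with hm
      have hmE : m + u = N.E.ncard := Set.ncard_sdiff_add_ncard_of_subset hSnE N.ground_finite
      have hmu : m = p + d - u := by omega
      set k := d + 1 - r with hk
      -- the exclusion credit is honest, with `o` outside triangles
      have hXgen : ∀ o, o ≤ t → {C : Set α | N.IsCircuit C ∧ C.ncard = 3 ∧ ¬ C ⊆ Sn}.ncard ≤ o →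
          exclXc (p + d) m k S t (t - o) ≤
            {B : Set α | B ⊆ N.E ∧ B.ncard = 4 ∧ N.eRk B = 4 ∧ k ≤ (B \ Sn).ncard}.ncard := by
        intro o hot ho
        unfold exclXc
        split_ifs with hk24 hm2
        · -- `m = 2 = k`: the refined count
          obtain ⟨hm2', hk2'⟩ := hm2
          have h := excl_ge_two N hcirc hC1 (S := Sn) (by rw [← hm]; exact hm2')
          rw [hNn'] at h
          have hexcl : exclCount (p + d) 2 2 = (p + d - 2).choose 2 := by
            unfold exclCount
            rw [show (2 : ℕ).choose 4 = 0 from Nat.choose_eq_zero_of_lt (by norm_num)]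
            simp
          rw [hexcl, hk2']
          have h2 : {C : Set α | N.IsCircuit C ∧ C.ncard = 3 ∧ ¬ C ⊆ Sn}.ncard ≤ t - (t - o) := by omega
          omega
        · have h := excl_ge_all N hcirc Sn hk24.1 hk24.2
          rw [hNn', ← hm] at h
          unfold exclX
          have h2 : {C : Set α | N.IsCircuit C ∧ C.ncard = 3 ∧ ¬ C ⊆ Sn}.ncard * (p + d - 3) ≤
              (t - (t - o)) * (p + d - 3) := Nat.mul_le_mul_right _ (by omega)
          omega
        · exact Nat.zero_le _
      rcases hcase with ⟨h𝒟r, hSu, hout⟩ | ⟨h𝒟r, hSu, hall⟩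
      · -- (A) the chain of `r` triangles
        have hout0 : {C : Set α | N.IsCircuit C ∧ C.ncard = 3 ∧ ¬ C ⊆ Sn}.ncard + r ≤ t := hout
        have hout' : {C : Set α | N.IsCircuit C ∧ C.ncard = 3 ∧ ¬ C ⊆ Sn}.ncard ≤ t - r := by omega
        have hX := hXgen (t - r) (by omega) hout'
        have htr : t - (t - r) = r := by omega
        rw [htr] at hX
        have huI : u ∈ Finset.Icc 3 (3 * r) := Finset.mem_Icc.2 ⟨hSn3, by omega⟩
        have hj𝒟 : jd r u ≤ 𝒟.card := by unfold jd; omega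
        refine hline 𝒟 h𝒟tri h𝒟disj (jd r u) (by unfold jd; omega) hj𝒟 Sn hSnE r k _ hSnν (by omega) hX ?_
        have := hokA t htI u huI
        rwa [← hmu] at this
      · -- (B) every triangle inside `Sn`
        have hout0 : {C : Set α | N.IsCircuit C ∧ C.ncard = 3 ∧ ¬ C ⊆ Sn}.ncard ≤ 0 := by
          have hempty : {C : Set α | N.IsCircuit C ∧ C.ncard = 3 ∧ ¬ C ⊆ Sn} = ∅ := by
            ext C
            simp only [Set.mem_setOf_eq, Set.mem_empty_iff_false, iff_false]
            rintro ⟨h1, h2, h3⟩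
            exact h3 (hall C h1 h2)
          rw [hempty, Set.ncard_empty]
        have hX := hXgen 0 (Nat.zero_le _) hout0
        rw [Nat.sub_zero] at hX
        have huI : u ∈ Finset.Icc 3 (3 * r - 3) := Finset.mem_Icc.2 ⟨hSn3, by omega⟩
        have hj𝒟 : jd (r - 1) u ≤ 𝒟.card := by unfold jd; omega
        refine hline 𝒟 h𝒟tri h𝒟disj (jd (r - 1) u) (by unfold jd; omega) hj𝒟 Sn hSnE r k _ hSnν (by omega) hX ?_
        have := hokB t htI u huI
        rwa [← hmu] at this
  rw [ThmN.RLS_iff, hNtop]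
  rw [hn] at hNmid
  have hmidQ : ((Matroid.midCount N p 4 : ℕ) : ℚ) + ((∑ j ∈ Finset.range c, 2 ^ (n - 1 - j) : ℕ) : ℚ) ≤
      ((Matroid.midCount M (p + c) 4 : ℕ) : ℚ) + ((∑ j ∈ Finset.range c, w3plus (n - 1 - j) : ℕ) : ℚ) := by
    exact_mod_cast hNmid
  linarith

end S1

end PercRepro
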